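import Literature.NumberTheory.LFunctions.DedekindZetaFiniteOrderProofs
import Literature.NumberTheory.LFunctions.DedekindZetaFunctionalEquationProofs
import Literature.NumberTheory.LFunctions.DedekindZetaNonvanishing
import Literature.NumberTheory.LFunctions.RHGeneralizedRHProofs
import HarnessLib

/-!
# `ζ_K ∈ 𝒮` and "Selberg's GRH implies ERH" — unconditional assembly

Topic `Literature/NumberTheory/LFunctions`, sibling proofs file (D-0014) of `RHGeneralizedRH.lean`
and `DedekindZetaFiniteOrder.lean`. It discharges, for every number field, the three remaining
named facts of the chain *Grand Riemann Hypothesis for the Selberg class ⇒ Extended Riemann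
Hypothesis* (Kaczorowski–Perelli, *The Selberg class: a survey* (1999), §1; Kaczorowski,
*Axiomatic theory of `L`-functions: the Selberg class* (2006), §2.1, Example 3: "`ζ_K(s)`, the
Dedekind zeta function of an algebraic number field `K`" is a member of `𝒮`):

* `Literature.NumberTheory.LFunctions.dedekindZetaCont_finiteOrder_holds` — `(s − 1) ζ_K(s)` has
  finite order (`DedekindZetaFiniteOrder.lean`): the tree's reduction to the functional equation
  (`NumberField.dedekindZetaCont_finiteOrder_of_completedDedekindZeta_one_sub`,
  `DedekindZetaFiniteOrderProofs.lean`) fed with Hecke's functional equation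
  `completedDedekindZeta_one_sub_holds` (`DedekindZetaFunctionalEquationProofs.lean`,
  Neukirch VII (5.10));
* `Literature.NumberTheory.LFunctions.exists_selbergDatum_dedekindZetaCont_holds` — **the Dedekind
  zeta function of every number field belongs to the Selberg class**, with degree `[K : ℚ]` and a
  simple pole (`RHGeneralizedRH.lean`): the conditional assembly
  `exists_selbergDatum_dedekindZetaCont_of` (`RHGeneralizedRHDedekindProofs.lean`: Ramanujan bound,
  Euler product, Selberg normalisation of the gamma factor, all proved there) fed with the four
  Hecke facts, now theorems — (H) continuation `NumberField.exists_isDedekindZetaContinuation_holds`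
  (`DedekindZetaThetaProofs.lean`), (P) simple pole `tendsto_sub_one_mul_dedekindZetaCont_holds`
  (`DedekindZetaNonvanishing.lean`), (FE) `completedDedekindZeta_one_sub_holds`, (FO)
  `dedekindZetaCont_finiteOrder_holds`;
* `Literature.NumberTheory.LFunctions.SelbergGrandRiemannHypothesis.extendedRiemannHypothesis_holds`
  — **Selberg's GRH implies ERH** (`RHGeneralizedRH.lean`), through
  `SelbergGrandRiemannHypothesis.extendedRiemannHypothesis_of`.

Appended: `Literature.NumberTheory.LFunctions.SelbergGrandRiemannHypothesis.generalizedRiemannHypothesis_holds`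
— **Selberg's GRH implies GRH for Dirichlet `L`-functions** (`RHGeneralizedRH.lean`), by composing
with `ExtendedRiemannHypothesis.generalizedRiemannHypothesis_holds` (`RHGeneralizedRHProofs.lean`:
ERH ⇒ GRH through the cyclotomic fields, Washington Thm. 4.3).

Both hypotheses remain open conjectures (`def … : Prop`, CONVENTIONS §4); what is proved is the
implication, member by member (`ζ_K ∈ 𝒮`). No definitions.

## References

* J. Kaczorowski, A. Perelli, *The Selberg class: a survey*, in: Number Theory in Progress, Vol. 2
  (Zakopane 1997), de Gruyter 1999, 953–992, §1. [KaczorowskiPerelli1999]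
* J. Kaczorowski, *Axiomatic theory of `L`-functions: the Selberg class*, in: Analytic Number
  Theory (C.I.M.E. Cetraro 2002), Lecture Notes in Math. 1891, Springer 2006, 133–209, §2.1
  axioms (1)–(5) and Example 3 (pp. 156–157 = PDF pp. 133–134 of the held copy
  `book:friedlandernd-analytic-number-theory`). [KaczorowskiSelbergClass2006]
* J. Neukirch, *Algebraic Number Theory*, Springer 1999, Ch. VII §5. [NeukirchANT1999]
-/

noncomputable section

namespace Literature.NumberTheory.LFunctions

/-- **Discharge of `dedekindZetaCont_finiteOrder K`** for every number field `K`: `(s − 1) ζ_K(s)`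
satisfies `‖(s − 1) ζ_K(s)‖ ≤ A exp(‖s‖^B)` off `s = 1` (Selberg's axiom (ii) for `ζ_K`, growth
half; Kaczorowski 2006, §2.1 axiom (2) with Example 3) — the tree's reduction to the functional
equation (`NumberField.dedekindZetaCont_finiteOrder_of_completedDedekindZeta_one_sub`) and Hecke's
functional equation `completedDedekindZeta_one_sub_holds`.
[cite: KaczorowskiSelbergClass2006, §2.1 axiom (2) and Example 3, pp. 156–157] -/
theorem dedekindZetaCont_finiteOrder_holds (K : Type*) [Field K] [NumberField K] :
    dedekindZetaCont_finiteOrder K :=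
  NumberField.dedekindZetaCont_finiteOrder_of_completedDedekindZeta_one_sub
    completedDedekindZeta_one_sub_holds

/-- **Discharge of `exists_selbergDatum_dedekindZetaCont`: the Dedekind zeta function of every
number field belongs to the Selberg class**, with degree `[K : ℚ]` and a simple pole at `s = 1`
(Kaczorowski, *Axiomatic theory of `L`-functions: the Selberg class*, §2.1 Example 3, p. 157;
Kaczorowski–Perelli, *The Selberg class: a survey* (1999), §1). The four Hecke facts required by
`exists_selbergDatum_dedekindZetaCont_of` (`RHGeneralizedRHDedekindProofs.lean`) are theorems:
Hecke's continuation (`NumberField.exists_isDedekindZetaContinuation_holds`), the simple pole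
(`tendsto_sub_one_mul_dedekindZetaCont_holds`), the functional equation
(`completedDedekindZeta_one_sub_holds`) and the finite order (`dedekindZetaCont_finiteOrder_holds`).
[cite: KaczorowskiSelbergClass2006, §2.1 Example 3 (p. 157) with §1.2 (1.5)–(1.8) (p. 139)] -/
theorem exists_selbergDatum_dedekindZetaCont_holds : exists_selbergDatum_dedekindZetaCont :=
  exists_selbergDatum_dedekindZetaCont_of
    (fun K _ _ ↦ NumberField.exists_isDedekindZetaContinuation_holds K)
    (fun K _ _ ↦ tendsto_sub_one_mul_dedekindZetaCont_holds K)
    (fun K _ _ ↦ completedDedekindZeta_one_sub_holds (K := K))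
    (fun K _ _ ↦ dedekindZetaCont_finiteOrder_holds K)

/-- **Discharge of `SelbergGrandRiemannHypothesis.extendedRiemannHypothesis`: the Grand Riemann
Hypothesis for the Selberg class implies the Extended Riemann Hypothesis.** Every Dedekind zeta
function `ζ_K = dedekindZetaCont K` underlies a Selberg datum
(`exists_selbergDatum_dedekindZetaCont_holds`: `ζ_K ∈ 𝒮`, Kaczorowski 2006 §2.1 Example 3;
Kaczorowski–Perelli 1999, §1), so the Riemann hypothesis for all of `𝒮` gives, for every number
field `K`, that the zeros of `ζ_K` in the open critical strip lie on `re s = 1/2`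
(`SelbergGrandRiemannHypothesis.extendedRiemannHypothesis_of`, `RHGeneralizedRH.lean`). Both
hypotheses are open; this is the (now unconditional) implication between them.
[cite: KaczorowskiPerelli1999, §1] -/
theorem SelbergGrandRiemannHypothesis.extendedRiemannHypothesis_holds :
    SelbergGrandRiemannHypothesis.extendedRiemannHypothesis :=
  SelbergGrandRiemannHypothesis.extendedRiemannHypothesis_of
    exists_selbergDatum_dedekindZetaCont_holds

/-- **Discharge of `SelbergGrandRiemannHypothesis.generalizedRiemannHypothesis`: the Grand Riemann
Hypothesis for the Selberg class implies GRH for Dirichlet `L`-functions** — composition of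
`SelbergGrandRiemannHypothesis.extendedRiemannHypothesis_holds` (Selberg GRH ⇒ ERH, `ζ_K ∈ 𝒮`) with
`ExtendedRiemannHypothesis.generalizedRiemannHypothesis_holds` (ERH ⇒ GRH, through
`ζ_{ℚ(ζ_N)} = ∏_χ L(s, χ⋆)`, Washington Thm. 4.3; `RHGeneralizedRHProofs.lean`); equivalently, and as
the docstring of the fact says, directly through `L(s, χ⋆) ∈ 𝒮` (Kaczorowski–Perelli 1999, §1;
Davenport ch. 20). All three hypotheses are open; this is the implication.
[cite: KaczorowskiPerelli1999, §1] -/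
theorem SelbergGrandRiemannHypothesis.generalizedRiemannHypothesis_holds :
    SelbergGrandRiemannHypothesis.generalizedRiemannHypothesis :=
  fun h ↦ ExtendedRiemannHypothesis.generalizedRiemannHypothesis_holds
    (SelbergGrandRiemannHypothesis.extendedRiemannHypothesis_holds h)

end Literature.NumberTheory.LFunctions

end
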